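import Summits.QuantumFields.BalabanUV.Beta.FP.SymmetryLimit
import Summits.QuantumFields.BalabanUV.Beta.FP.PerfectObjectsT
import Summits.QuantumFields.BalabanUV.Beta.HessKerDressedUnitsWall

/-!
# `BalabanUV.Beta.FP.SymmetryInherit` — road «FP» for binder row D1, leaf N3-inherit AT THE WALL FAMILY / THE PERFECT TRIPLE (`m = 1`):
# the printed symmetry class (axis-reflection covariance (5.7)–(5.8), Ward transversality (5.9)) of the wall's family `TbalOf Lc (JsBalOf …) j`
# passes to the perfect one-step kernel `TPerfOf Lc (KPerf … 1) (SPerfOf … 1) (WPerfOf … 1)` under (CONV-C-Cauchy) — ZERO new mathematics: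
# the owner's closure `FP/SymmetryLimit` INSTANTIATED with asym1's entrywise convergence of the dressed family

HONEST FRAMING (cell contract, verbatim): «discharging `BetaPertH` makes Bałaban's UV stability UNCONDITIONAL — a real constructive-QFT
result; it is NOT the continuum limit and NOT the Clay problem.»  THIS MODULE DISCHARGES NOTHING of the wall: the finite-`j` symmetry rows
`hR : ∀ j, AxisReflectionCovariant (flipK (TbalOf Lc Js j))` (an2's row) and `hW : ∀ j, WardTransversal (flipK (TbalOf Lc Js j))` (an1's row)
— two of the four binders of `OneStepKernelFamily.d1Drift_of_D1Tel_D1Rep` — and the (CONV-C-Cauchy) data (row G-an2-4) enter as HYPOTHESES,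
verbatim.  Composed BY NAME: `FP/SymmetryLimit.axisReflectionCovariant_flipK_of_tendsto` / `wardTransversal_flipK_of_tendsto` (p207256),
asym1's `HessKerDressedUnitsWall.TbalOf_JsBalOf_unit_eq` + `HessKerDressedLimit.geometricRate_hessKer_dress_of_pointwise_lim` +
`LimitRate.GeometricRate.tendsto_apply` (the KERNEL-LEVEL pointwise convergence behind `limKernelOf_TbalOf_JsBalOf_apply_unit`, exposed as a
`Tendsto`), the typer's `FP/PerfectObjectsT.KPerf_one` / `SPerfOf_one` / `WPerfOf_one` (p207437).  Skeleton
`HOME/beta/skeletons/D1-b2b-balaban-beta-d1-p3.md` §3 N3-inherit («SIZE S given the an1/an2 rows; zero new mathematics»); claim table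
`HOME/b2b-balaban-beta-d1-p3/LEAVES-FP.md` row N3-inherit, sub-row N3-inherit-wall (unit `b2b-balaban-beta-d1-formalise-leaf-06`).
`m ≥ 2` (the perfect `m`-fold step) is NOT here (it is N1 + N3 proper).  NOT BetaPertH, NOT continuum, NOT Clay.

ABSOLUTE RULE (cell, verbatim): «No internally-minted statement may enter as a cited fact. Every hypothesis is either kernel-proved in this
package or a verbatim quotation of a PUBLISHED theorem with page reference.»  Nothing is cited; no `def … : Prop`; no binder instantiated at a
value; `AxisReflectionCovariant` / `WardTransversal` are the cell's typed PREDICATES (`PolarizationSign`), used as hypothesis / conclusion shapes.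

CONTENT (all [folklore] / [our object]; `d = 3`, any nonzero unit sequences `sf, sm`).
* §1 LIMIT CURRENCY, NAMED LIMITS `(K∞, S∞, W∞)`: `tendsto_TbalOf_JsBalOf_apply_unit` (every entry `TbalOf Lc (JsBalOf …) j μ ν x` converges to
  `hessKer (axDressK Lc K∞) (axVertexOfK K∞ Lc S∞) W∞ μ ν x` under the nine binders, `0 ≤ θ < 1`); **`axisReflectionCovariant_flipK_lim_unit`**,
  **`wardTransversal_flipK_lim_unit`**.
* §2 AT THE PERFECT TRIPLE (`m = 1`; in LIMIT currency the perfect objects enter as NAMED limits, no pin needed): `tendsto_TbalOf_TPerfOf_one`,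
  **`axisReflectionCovariant_flipK_TPerfOf_one`**, **`wardTransversal_flipK_TPerfOf_one`** — binder list EXACTLY that of
  `PerfectObjectsT.d1Drift_JsBalOf_of_perfect_step_law_bounded` (minus `hS1`/`hW1`/`hstep`/`hasym`) plus `hRj` / `hWj`.
* §3 CAUCHY CURRENCY (six all-scales binders on the rescaled primitives; the limits ARE the constructed ones, i.e. the perfect objects, the
  `m = 1` members pinned by `hS1`/`hW1` as in `PerfectObjectsT`):
  `tendsto_TbalOf_TPerfOf_one_of_cauchy`, **`axisReflectionCovariant_flipK_TPerfOf_one_of_cauchy`**, **`wardTransversal_flipK_TPerfOf_one_of_cauchy`**.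
-/

namespace Summit.QuantumFields.BalabanUV.Beta.FP.SymmetryInherit

open Filter Topology
open Literature.MathematicalPhysics.QuantumFieldTheory.Balaban1983to89
open Literature.MathematicalPhysics.QuantumFieldTheory.Balaban1983to89.Beta
open ExpKernelCalculus (MKer Decays VertexFamily₂ hessKer)
open PolarizationSign (WardTransversal AxisReflectionCovariant)
open OneStepResolventKernel (Fib LocStencil)
open OneStepKernelFamily (KInvStep TbalOf flipK)
open AxialDressing (axDressK axVertexOfK)
open BalabanStepJetsSucc (JsBal0Of JsBalOf)
open HessKerDressedCauchy (one_le_Lc)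
open HessKerDressedLimit (limMKerOf limStOf limTabOf decays_limMKerOf decays_sub_limMKerOf locStencil_limStOf locStencil_sub_limStOf
  vertexFamily₂_limTabOf vertexFamily₂_sub_limTabOf geometricRate_hessKer_dress_of_pointwise_lim)
open Summit.QuantumFields.BalabanUV.Beta.HessKerDressedUnits (unitK unitS unitW)
open Summit.QuantumFields.BalabanUV.Beta.HessKerDressedUnitsWall (TbalOf_JsBalOf_unit_eq)
open Summit.QuantumFields.BalabanUV.Beta.FP.SymmetryLimit (axisReflectionCovariant_flipK_of_tendsto wardTransversal_flipK_of_tendsto)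
open Summit.QuantumFields.BalabanUV.Beta.FP.PerfectObjectsT (KPerf KPerf_one SPerfOf SPerfOf_one WPerfOf WPerfOf_one TPerfOf)

noncomputable section

variable {Lc : ℕ} [NeZero Lc] (hLc : 1 ≤ Lc) (cE cVH cΛ : ℝ)
  (W : ℕ → Fin (3 + 1) → (Fin (3 + 1) → ℤ) → Fin (3 + 1) → (Fin (3 + 1) → ℤ) → MKer (3 + 1) (Fib 3))
  (Cw' δw : ℕ → ℝ) (hδw : ∀ j, 0 < δw j) (hW' : ∀ j, VertexFamily₂ (W j) Lc (Cw' j) (δw j))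
  (sf sm : ℕ → ℝ)

/-! ## §1 Limit currency, named limit primitives, any units -/

section Named

variable {Kinf : MKer (3 + 1) (Fib 3)} {Sinf : Fin (3 + 1) → (Fin (3 + 1) → ℤ) → MKer (3 + 1) (Fib 3)}
  {Winf : Fin (3 + 1) → (Fin (3 + 1) → ℤ) → Fin (3 + 1) → (Fin (3 + 1) → ℤ) → MKer (3 + 1) (Fib 3)}
  {R C cK δK Cs cS δS Cw cW δW θ : ℝ}

/-- [folklore] **THE WALL'S FAMILY MEMBER CONVERGES ENTRYWISE TO THE DRESSED HESSIAN KERNEL OF THE LIMIT PRIMITIVES**: under asym1's nine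
limit-currency (CONV-C-Cauchy) binders on the RESCALED primitives (any nonzero units) to named limits `(K∞, S∞, W∞)` and `0 ≤ θ < 1`,
`TbalOf Lc (JsBalOf …) j μ ν x → hessKer (axDressK Lc K∞) (axVertexOfK K∞ Lc S∞) W∞ μ ν x` (`TbalOf_JsBalOf_unit_eq` +
`geometricRate_hessKer_dress_of_pointwise_lim` + `GeometricRate.tendsto_apply`, BY NAME). -/
theorem tendsto_TbalOf_JsBalOf_apply_unit (hsf : ∀ j, sf j ≠ 0) (hsm : ∀ j, sm j ≠ 0)
    (hK : ∀ j, Decays (unitK (sf j) (sm j) (KInvStep (d := 3) Lc j)) C δK) (hKinf : Decays Kinf C δK)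
    (hKrate : ∀ j, Decays (unitK (sf j) (sm j) (KInvStep (d := 3) Lc j) - Kinf) (cK * θ ^ j) δK)
    (hS : ∀ j, LocStencil (unitS (sf j) (sm j) (JsBal0Of hLc cE cVH cΛ W Cw' δw hδw hW' j).S) Cs δS) (hSinf : LocStencil Sinf Cs δS)
    (hSrate : ∀ j, LocStencil (unitS (sf j) (sm j) (JsBal0Of hLc cE cVH cΛ W Cw' δw hδw hW' j).S - Sinf) (cS * θ ^ j) δS)
    (hW : ∀ j, VertexFamily₂ (unitW (sf j) (sm j) (W j)) Lc Cw δW) (hWinf : VertexFamily₂ Winf Lc Cw δW)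
    (hWrate : ∀ j, VertexFamily₂ (unitW (sf j) (sm j) (W j) - Winf) Lc (cW * θ ^ j) δW)
    (hR : 0 < R) (hRK : R < δK) (hRS : R / 2 < δS) (hRW : R < δW) (hθ0 : 0 ≤ θ) (hθ1 : θ < 1) (μ ν : Fin 4) (x : Fin 4 → ℤ) :
    Tendsto (fun j => TbalOf Lc (JsBalOf hLc cE cVH cΛ W Cw' δw hδw hW') j μ ν x) atTop
      (𝓝 (hessKer (axDressK Lc Kinf) (axVertexOfK Kinf Lc Sinf) Winf μ ν x)) := by
  rw [TbalOf_JsBalOf_unit_eq hLc cE cVH cΛ W Cw' δw hδw hW' sf sm hsf hsm]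
  exact (geometricRate_hessKer_dress_of_pointwise_lim (K := fun j => unitK (sf j) (sm j) (KInvStep (d := 3) Lc j))
    (S := fun j => unitS (sf j) (sm j) (JsBal0Of hLc cE cVH cΛ W Cw' δw hδw hW' j).S) (W := fun j => unitW (sf j) (sm j) (W j))
    one_le_Lc hK hKinf hKrate hS hSinf hSrate hW hWinf hWrate hR hRK hRS hRW μ ν).tendsto_apply hθ0 hθ1 x

/-- **AXIS-REFLECTION COVARIANCE (5.7)–(5.8) OF THE DRESSED LIMIT KERNEL, INHERITED**: the finite-`j` row `hR` of the wall family (an2's;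
a HYPOTHESIS here) + the nine limit-currency binders ⟹ `AxisReflectionCovariant (flipK (hessKer (axDressK Lc K∞) (axVertexOfK K∞ Lc S∞) W∞))`. [our object] -/
theorem axisReflectionCovariant_flipK_lim_unit (hsf : ∀ j, sf j ≠ 0) (hsm : ∀ j, sm j ≠ 0)
    (hK : ∀ j, Decays (unitK (sf j) (sm j) (KInvStep (d := 3) Lc j)) C δK) (hKinf : Decays Kinf C δK)
    (hKrate : ∀ j, Decays (unitK (sf j) (sm j) (KInvStep (d := 3) Lc j) - Kinf) (cK * θ ^ j) δK)
    (hS : ∀ j, LocStencil (unitS (sf j) (sm j) (JsBal0Of hLc cE cVH cΛ W Cw' δw hδw hW' j).S) Cs δS) (hSinf : LocStencil Sinf Cs δS)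
    (hSrate : ∀ j, LocStencil (unitS (sf j) (sm j) (JsBal0Of hLc cE cVH cΛ W Cw' δw hδw hW' j).S - Sinf) (cS * θ ^ j) δS)
    (hW : ∀ j, VertexFamily₂ (unitW (sf j) (sm j) (W j)) Lc Cw δW) (hWinf : VertexFamily₂ Winf Lc Cw δW)
    (hWrate : ∀ j, VertexFamily₂ (unitW (sf j) (sm j) (W j) - Winf) Lc (cW * θ ^ j) δW)
    (hR : 0 < R) (hRK : R < δK) (hRS : R / 2 < δS) (hRW : R < δW) (hθ0 : 0 ≤ θ) (hθ1 : θ < 1)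
    (hRj : ∀ j, AxisReflectionCovariant (flipK (TbalOf Lc (JsBalOf hLc cE cVH cΛ W Cw' δw hδw hW') j))) :
    AxisReflectionCovariant (flipK (hessKer (axDressK Lc Kinf) (axVertexOfK Kinf Lc Sinf) Winf)) :=
  axisReflectionCovariant_flipK_of_tendsto hRj fun μ ν z =>
    tendsto_TbalOf_JsBalOf_apply_unit hLc cE cVH cΛ W Cw' δw hδw hW' sf sm hsf hsm hK hKinf hKrate hS hSinf hSrate hW hWinf hWrate hR hRK
      hRS hRW hθ0 hθ1 μ ν z

/-- **WARD TRANSVERSALITY (5.9) OF THE DRESSED LIMIT KERNEL, INHERITED**: the finite-`j` row `hW` of the wall family (an1's; a HYPOTHESIS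
here) + the nine limit-currency binders ⟹ `WardTransversal (flipK (hessKer (axDressK Lc K∞) (axVertexOfK K∞ Lc S∞) W∞))`. [our object] -/
theorem wardTransversal_flipK_lim_unit (hsf : ∀ j, sf j ≠ 0) (hsm : ∀ j, sm j ≠ 0)
    (hK : ∀ j, Decays (unitK (sf j) (sm j) (KInvStep (d := 3) Lc j)) C δK) (hKinf : Decays Kinf C δK)
    (hKrate : ∀ j, Decays (unitK (sf j) (sm j) (KInvStep (d := 3) Lc j) - Kinf) (cK * θ ^ j) δK)
    (hS : ∀ j, LocStencil (unitS (sf j) (sm j) (JsBal0Of hLc cE cVH cΛ W Cw' δw hδw hW' j).S) Cs δS) (hSinf : LocStencil Sinf Cs δS)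
    (hSrate : ∀ j, LocStencil (unitS (sf j) (sm j) (JsBal0Of hLc cE cVH cΛ W Cw' δw hδw hW' j).S - Sinf) (cS * θ ^ j) δS)
    (hW : ∀ j, VertexFamily₂ (unitW (sf j) (sm j) (W j)) Lc Cw δW) (hWinf : VertexFamily₂ Winf Lc Cw δW)
    (hWrate : ∀ j, VertexFamily₂ (unitW (sf j) (sm j) (W j) - Winf) Lc (cW * θ ^ j) δW)
    (hR : 0 < R) (hRK : R < δK) (hRS : R / 2 < δS) (hRW : R < δW) (hθ0 : 0 ≤ θ) (hθ1 : θ < 1)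
    (hWj : ∀ j, WardTransversal (flipK (TbalOf Lc (JsBalOf hLc cE cVH cΛ W Cw' δw hδw hW') j))) :
    WardTransversal (flipK (hessKer (axDressK Lc Kinf) (axVertexOfK Kinf Lc Sinf) Winf)) :=
  wardTransversal_flipK_of_tendsto hWj fun μ ν z =>
    tendsto_TbalOf_JsBalOf_apply_unit hLc cE cVH cΛ W Cw' δw hδw hW' sf sm hsf hsm hK hKinf hKrate hS hSinf hSrate hW hWinf hWrate hR hRK
      hRS hRW hθ0 hθ1 μ ν z

end Named

/-! ## §2 At the perfect triple (`m = 1`), limit currency -/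

section Perfect

variable (S : ℕ → ℕ → Fin (3 + 1) → (Fin (3 + 1) → ℤ) → MKer (3 + 1) (Fib 3))
  (Wt : ℕ → ℕ → Fin (3 + 1) → (Fin (3 + 1) → ℤ) → Fin (3 + 1) → (Fin (3 + 1) → ℤ) → MKer (3 + 1) (Fib 3))
  {R C cK δK Cs cS δS Cw cW δW θ : ℝ}

/-- [our object] **THE WALL'S FAMILY MEMBER CONVERGES ENTRYWISE TO THE PERFECT ONE-STEP KERNEL** `TPerfOf Lc (KPerf … 1) (SPerfOf … 1) (WPerfOf … 1)`
under the nine limit-currency binders AT THE PERFECT TRIPLE (the shapes of `PerfectObjectsT.d1Drift_JsBalOf_of_perfect_step_law_bounded`; in this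
currency the perfect objects are NAMED limits, so no `m = 1` pin is needed), `0 ≤ θ < 1`. -/
theorem tendsto_TbalOf_TPerfOf_one (hsf : ∀ j, sf j ≠ 0) (hsm : ∀ j, sm j ≠ 0)
    (hK : ∀ j, Decays (unitK (sf j) (sm j) (KInvStep (d := 3) Lc j)) C δK) (hKinf : Decays (KPerf (d := 3) Lc sf sm 1) C δK)
    (hKrate : ∀ j, Decays (unitK (sf j) (sm j) (KInvStep (d := 3) Lc j) - KPerf (d := 3) Lc sf sm 1) (cK * θ ^ j) δK)
    (hS : ∀ j, LocStencil (unitS (sf j) (sm j) (JsBal0Of hLc cE cVH cΛ W Cw' δw hδw hW' j).S) Cs δS) (hSinf : LocStencil (SPerfOf sf sm S 1) Cs δS)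
    (hSrate : ∀ j, LocStencil (unitS (sf j) (sm j) (JsBal0Of hLc cE cVH cΛ W Cw' δw hδw hW' j).S - SPerfOf sf sm S 1) (cS * θ ^ j) δS)
    (hW : ∀ j, VertexFamily₂ (unitW (sf j) (sm j) (W j)) Lc Cw δW) (hWinf : VertexFamily₂ (WPerfOf sf sm Wt 1) Lc Cw δW)
    (hWrate : ∀ j, VertexFamily₂ (unitW (sf j) (sm j) (W j) - WPerfOf sf sm Wt 1) Lc (cW * θ ^ j) δW)
    (hR : 0 < R) (hRK : R < δK) (hRS : R / 2 < δS) (hRW : R < δW) (hθ0 : 0 ≤ θ) (hθ1 : θ < 1) (μ ν : Fin 4) (x : Fin 4 → ℤ) :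
    Tendsto (fun j => TbalOf Lc (JsBalOf hLc cE cVH cΛ W Cw' δw hδw hW') j μ ν x) atTop
      (𝓝 (TPerfOf Lc (KPerf (d := 3) Lc sf sm 1) (SPerfOf sf sm S 1) (WPerfOf sf sm Wt 1) μ ν x)) := by
  have h := tendsto_TbalOf_JsBalOf_apply_unit hLc cE cVH cΛ W Cw' δw hδw hW' sf sm hsf hsm hK hKinf hKrate hS hSinf hSrate hW hWinf hWrate
    hR hRK hRS hRW hθ0 hθ1 μ ν x
  rwa [TPerfOf]

/-- **AXIS-REFLECTION COVARIANCE OF THE PERFECT ONE-STEP KERNEL, INHERITED FROM `hR`**: `∀ j, AxisReflectionCovariant (flipK (TbalOf Lc (JsBalOf …) j))`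
+ the nine limit-currency binders at the perfect triple ⟹ `AxisReflectionCovariant (flipK (TPerfOf Lc (KPerf … 1) (SPerfOf … 1) (WPerfOf … 1)))`.
[our object] -/
theorem axisReflectionCovariant_flipK_TPerfOf_one (hsf : ∀ j, sf j ≠ 0) (hsm : ∀ j, sm j ≠ 0)
    (hK : ∀ j, Decays (unitK (sf j) (sm j) (KInvStep (d := 3) Lc j)) C δK) (hKinf : Decays (KPerf (d := 3) Lc sf sm 1) C δK)
    (hKrate : ∀ j, Decays (unitK (sf j) (sm j) (KInvStep (d := 3) Lc j) - KPerf (d := 3) Lc sf sm 1) (cK * θ ^ j) δK)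
    (hS : ∀ j, LocStencil (unitS (sf j) (sm j) (JsBal0Of hLc cE cVH cΛ W Cw' δw hδw hW' j).S) Cs δS) (hSinf : LocStencil (SPerfOf sf sm S 1) Cs δS)
    (hSrate : ∀ j, LocStencil (unitS (sf j) (sm j) (JsBal0Of hLc cE cVH cΛ W Cw' δw hδw hW' j).S - SPerfOf sf sm S 1) (cS * θ ^ j) δS)
    (hW : ∀ j, VertexFamily₂ (unitW (sf j) (sm j) (W j)) Lc Cw δW) (hWinf : VertexFamily₂ (WPerfOf sf sm Wt 1) Lc Cw δW)
    (hWrate : ∀ j, VertexFamily₂ (unitW (sf j) (sm j) (W j) - WPerfOf sf sm Wt 1) Lc (cW * θ ^ j) δW)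
    (hR : 0 < R) (hRK : R < δK) (hRS : R / 2 < δS) (hRW : R < δW) (hθ0 : 0 ≤ θ) (hθ1 : θ < 1)
    (hRj : ∀ j, AxisReflectionCovariant (flipK (TbalOf Lc (JsBalOf hLc cE cVH cΛ W Cw' δw hδw hW') j))) :
    AxisReflectionCovariant (flipK (TPerfOf Lc (KPerf (d := 3) Lc sf sm 1) (SPerfOf sf sm S 1) (WPerfOf sf sm Wt 1))) :=
  axisReflectionCovariant_flipK_of_tendsto hRj fun μ ν z =>
    tendsto_TbalOf_TPerfOf_one hLc cE cVH cΛ W Cw' δw hδw hW' sf sm S Wt hsf hsm hK hKinf hKrate hS hSinf hSrate hW hWinf hWrate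
      hR hRK hRS hRW hθ0 hθ1 μ ν z

/-- **WARD TRANSVERSALITY OF THE PERFECT ONE-STEP KERNEL, INHERITED FROM `hW`**. [our object] -/
theorem wardTransversal_flipK_TPerfOf_one (hsf : ∀ j, sf j ≠ 0) (hsm : ∀ j, sm j ≠ 0)
    (hK : ∀ j, Decays (unitK (sf j) (sm j) (KInvStep (d := 3) Lc j)) C δK) (hKinf : Decays (KPerf (d := 3) Lc sf sm 1) C δK)
    (hKrate : ∀ j, Decays (unitK (sf j) (sm j) (KInvStep (d := 3) Lc j) - KPerf (d := 3) Lc sf sm 1) (cK * θ ^ j) δK)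
    (hS : ∀ j, LocStencil (unitS (sf j) (sm j) (JsBal0Of hLc cE cVH cΛ W Cw' δw hδw hW' j).S) Cs δS) (hSinf : LocStencil (SPerfOf sf sm S 1) Cs δS)
    (hSrate : ∀ j, LocStencil (unitS (sf j) (sm j) (JsBal0Of hLc cE cVH cΛ W Cw' δw hδw hW' j).S - SPerfOf sf sm S 1) (cS * θ ^ j) δS)
    (hW : ∀ j, VertexFamily₂ (unitW (sf j) (sm j) (W j)) Lc Cw δW) (hWinf : VertexFamily₂ (WPerfOf sf sm Wt 1) Lc Cw δW)
    (hWrate : ∀ j, VertexFamily₂ (unitW (sf j) (sm j) (W j) - WPerfOf sf sm Wt 1) Lc (cW * θ ^ j) δW)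
    (hR : 0 < R) (hRK : R < δK) (hRS : R / 2 < δS) (hRW : R < δW) (hθ0 : 0 ≤ θ) (hθ1 : θ < 1)
    (hWj : ∀ j, WardTransversal (flipK (TbalOf Lc (JsBalOf hLc cE cVH cΛ W Cw' δw hδw hW') j))) :
    WardTransversal (flipK (TPerfOf Lc (KPerf (d := 3) Lc sf sm 1) (SPerfOf sf sm S 1) (WPerfOf sf sm Wt 1))) :=
  wardTransversal_flipK_of_tendsto hWj fun μ ν z =>
    tendsto_TbalOf_TPerfOf_one hLc cE cVH cΛ W Cw' δw hδw hW' sf sm S Wt hsf hsm hK hKinf hKrate hS hSinf hSrate hW hWinf hWrate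
      hR hRK hRS hRW hθ0 hθ1 μ ν z

end Perfect

/-! ## §3 At the perfect triple (`m = 1`), Cauchy currency: the limits ARE the perfect objects -/

section Cauchy

variable (S : ℕ → ℕ → Fin (3 + 1) → (Fin (3 + 1) → ℤ) → MKer (3 + 1) (Fib 3))
  (Wt : ℕ → ℕ → Fin (3 + 1) → (Fin (3 + 1) → ℤ) → Fin (3 + 1) → (Fin (3 + 1) → ℤ) → MKer (3 + 1) (Fib 3))
  {R C cK δK Cs cS δS Cw cW δW θ : ℝ}

/-- [our object] **CAUCHY CURRENCY**: under the six all-scales (CONV-C-Cauchy) binders on the RESCALED primitives (`hK, hKall, hS, hSall, hW, hWall`, as in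
`HessKerDressedUnitsWall.limKernelOf_TbalOf_JsBalOf_apply_unit`) and `0 ≤ θ < 1`, every entry of the wall's family converges to the corresponding
entry of `TPerfOf Lc (KPerf … 1) (SPerfOf … 1) (WPerfOf … 1)` — the limits being the CONSTRUCTED ones (`KPerf_one`, `SPerfOf_one`, `WPerfOf_one`). -/
theorem tendsto_TbalOf_TPerfOf_one_of_cauchy (hsf : ∀ j, sf j ≠ 0) (hsm : ∀ j, sm j ≠ 0)
    (hS1 : ∀ j, S j 1 = (JsBal0Of hLc cE cVH cΛ W Cw' δw hδw hW' j).S) (hW1 : ∀ j, Wt j 1 = W j)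
    (hK : ∀ j, Decays (unitK (sf j) (sm j) (KInvStep (d := 3) Lc j)) C δK)
    (hKall : ∀ k j, Decays (unitK (sf (k + j)) (sm (k + j)) (KInvStep (d := 3) Lc (k + j)) -
      unitK (sf k) (sm k) (KInvStep (d := 3) Lc k)) (cK * θ ^ k) δK)
    (hS : ∀ j, LocStencil (unitS (sf j) (sm j) (JsBal0Of hLc cE cVH cΛ W Cw' δw hδw hW' j).S) Cs δS)
    (hSall : ∀ k j, LocStencil (unitS (sf (k + j)) (sm (k + j)) (JsBal0Of hLc cE cVH cΛ W Cw' δw hδw hW' (k + j)).S -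
      unitS (sf k) (sm k) (JsBal0Of hLc cE cVH cΛ W Cw' δw hδw hW' k).S) (cS * θ ^ k) δS)
    (hW : ∀ j, VertexFamily₂ (unitW (sf j) (sm j) (W j)) Lc Cw δW)
    (hWall : ∀ k j, VertexFamily₂ (unitW (sf (k + j)) (sm (k + j)) (W (k + j)) - unitW (sf k) (sm k) (W k)) Lc (cW * θ ^ k) δW)
    (hR : 0 < R) (hRK : R < δK) (hRS : R / 2 < δS) (hRW : R < δW) (hθ0 : 0 ≤ θ) (hθ1 : θ < 1) (μ ν : Fin 4) (x : Fin 4 → ℤ) :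
    Tendsto (fun j => TbalOf Lc (JsBalOf hLc cE cVH cΛ W Cw' δw hδw hW') j μ ν x) atTop
      (𝓝 (TPerfOf Lc (KPerf (d := 3) Lc sf sm 1) (SPerfOf sf sm S 1) (WPerfOf sf sm Wt 1) μ ν x)) := by
  rw [TPerfOf, KPerf_one (d := 3) Lc sf sm, SPerfOf_one sf sm hS1, WPerfOf_one sf sm hW1]
  exact tendsto_TbalOf_JsBalOf_apply_unit hLc cE cVH cΛ W Cw' δw hδw hW' sf sm hsf hsm hK (decays_limMKerOf hK hKall hθ1)
    (decays_sub_limMKerOf hKall hθ1) hS (locStencil_limStOf hS hSall hθ1) (locStencil_sub_limStOf hSall hθ1) hW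
    (vertexFamily₂_limTabOf hW hWall hθ1) (vertexFamily₂_sub_limTabOf hWall hθ1) hR hRK hRS hRW hθ0 hθ1 μ ν x

/-- **AXIS-REFLECTION COVARIANCE OF THE PERFECT ONE-STEP KERNEL FROM `hR`, CAUCHY CURRENCY**. [our object] -/
theorem axisReflectionCovariant_flipK_TPerfOf_one_of_cauchy (hsf : ∀ j, sf j ≠ 0) (hsm : ∀ j, sm j ≠ 0)
    (hS1 : ∀ j, S j 1 = (JsBal0Of hLc cE cVH cΛ W Cw' δw hδw hW' j).S) (hW1 : ∀ j, Wt j 1 = W j)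
    (hK : ∀ j, Decays (unitK (sf j) (sm j) (KInvStep (d := 3) Lc j)) C δK)
    (hKall : ∀ k j, Decays (unitK (sf (k + j)) (sm (k + j)) (KInvStep (d := 3) Lc (k + j)) -
      unitK (sf k) (sm k) (KInvStep (d := 3) Lc k)) (cK * θ ^ k) δK)
    (hS : ∀ j, LocStencil (unitS (sf j) (sm j) (JsBal0Of hLc cE cVH cΛ W Cw' δw hδw hW' j).S) Cs δS)
    (hSall : ∀ k j, LocStencil (unitS (sf (k + j)) (sm (k + j)) (JsBal0Of hLc cE cVH cΛ W Cw' δw hδw hW' (k + j)).S -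
      unitS (sf k) (sm k) (JsBal0Of hLc cE cVH cΛ W Cw' δw hδw hW' k).S) (cS * θ ^ k) δS)
    (hW : ∀ j, VertexFamily₂ (unitW (sf j) (sm j) (W j)) Lc Cw δW)
    (hWall : ∀ k j, VertexFamily₂ (unitW (sf (k + j)) (sm (k + j)) (W (k + j)) - unitW (sf k) (sm k) (W k)) Lc (cW * θ ^ k) δW)
    (hR : 0 < R) (hRK : R < δK) (hRS : R / 2 < δS) (hRW : R < δW) (hθ0 : 0 ≤ θ) (hθ1 : θ < 1)
    (hRj : ∀ j, AxisReflectionCovariant (flipK (TbalOf Lc (JsBalOf hLc cE cVH cΛ W Cw' δw hδw hW') j))) :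
    AxisReflectionCovariant (flipK (TPerfOf Lc (KPerf (d := 3) Lc sf sm 1) (SPerfOf sf sm S 1) (WPerfOf sf sm Wt 1))) :=
  axisReflectionCovariant_flipK_of_tendsto hRj fun μ ν z =>
    tendsto_TbalOf_TPerfOf_one_of_cauchy hLc cE cVH cΛ W Cw' δw hδw hW' sf sm S Wt hsf hsm hS1 hW1 hK hKall hS hSall hW hWall hR hRK hRS
      hRW hθ0 hθ1 μ ν z

/-- **WARD TRANSVERSALITY OF THE PERFECT ONE-STEP KERNEL FROM `hW`, CAUCHY CURRENCY**. [our object] -/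
theorem wardTransversal_flipK_TPerfOf_one_of_cauchy (hsf : ∀ j, sf j ≠ 0) (hsm : ∀ j, sm j ≠ 0)
    (hS1 : ∀ j, S j 1 = (JsBal0Of hLc cE cVH cΛ W Cw' δw hδw hW' j).S) (hW1 : ∀ j, Wt j 1 = W j)
    (hK : ∀ j, Decays (unitK (sf j) (sm j) (KInvStep (d := 3) Lc j)) C δK)
    (hKall : ∀ k j, Decays (unitK (sf (k + j)) (sm (k + j)) (KInvStep (d := 3) Lc (k + j)) -
      unitK (sf k) (sm k) (KInvStep (d := 3) Lc k)) (cK * θ ^ k) δK)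
    (hS : ∀ j, LocStencil (unitS (sf j) (sm j) (JsBal0Of hLc cE cVH cΛ W Cw' δw hδw hW' j).S) Cs δS)
    (hSall : ∀ k j, LocStencil (unitS (sf (k + j)) (sm (k + j)) (JsBal0Of hLc cE cVH cΛ W Cw' δw hδw hW' (k + j)).S -
      unitS (sf k) (sm k) (JsBal0Of hLc cE cVH cΛ W Cw' δw hδw hW' k).S) (cS * θ ^ k) δS)
    (hW : ∀ j, VertexFamily₂ (unitW (sf j) (sm j) (W j)) Lc Cw δW)
    (hWall : ∀ k j, VertexFamily₂ (unitW (sf (k + j)) (sm (k + j)) (W (k + j)) - unitW (sf k) (sm k) (W k)) Lc (cW * θ ^ k) δW)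
    (hR : 0 < R) (hRK : R < δK) (hRS : R / 2 < δS) (hRW : R < δW) (hθ0 : 0 ≤ θ) (hθ1 : θ < 1)
    (hWj : ∀ j, WardTransversal (flipK (TbalOf Lc (JsBalOf hLc cE cVH cΛ W Cw' δw hδw hW') j))) :
    WardTransversal (flipK (TPerfOf Lc (KPerf (d := 3) Lc sf sm 1) (SPerfOf sf sm S 1) (WPerfOf sf sm Wt 1))) :=
  wardTransversal_flipK_of_tendsto hWj fun μ ν z =>
    tendsto_TbalOf_TPerfOf_one_of_cauchy hLc cE cVH cΛ W Cw' δw hδw hW' sf sm S Wt hsf hsm hS1 hW1 hK hKall hS hSall hW hWall hR hRK hRS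
      hRW hθ0 hθ1 μ ν z

end Cauchy

end

end Summit.QuantumFields.BalabanUV.Beta.FP.SymmetryInherit
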